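import Summits.CriticalPhenomena.Ising3D.TaylorCoeffZMonoHalf
import Summits.CriticalPhenomena.Ising3D.TaylorCertificateRegion
import Mathlib.Tactic.Linarith
import Mathlib.Tactic.Positivity
import Mathlib.Tactic.Ring
import HarnessLib

/-!
# The even-sector region check of a derivative certificate at `(½,½)` is a POLYNOMIAL check
(cell `pub-ising3x`, seat boot-1; gate (g2)/(g3): what the exact producer / rational checker actually decides)

HONEST FRAMING: lottery ticket; floor = tightest certified 3D Ising CFT bounds; no exact-solution
claim without a proof.

For the concrete derivative crossing functional `α = taylorCrossing ½ ½ S w` the three numbers of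
`TaylorEvenRegion` at `(E, j)` and `(Δσ, Δε)` are (by `taylorCoeffAt_crossF_zMono_half`)
`X = (½)^{2Δσ} (½)^E X̂`, `Y = (½)^{2Δε} (½)^E Ŷ`, `Z = (½)^{Δσ+Δε} (½)^E Ẑ` with the WEIGHTED q-SUMS
`X̂ = qSum (w 0) S Δσ (-1) E j`, `Ŷ = qSum (w 1) S Δε (-1) E j`,
`Ẑ = qSum (w 3) S s (-1) E j + qSum (w 4) S s 1 E j` (`s = (Δσ+Δε)/2`) — finite sums of
`w(a,b) 2^{a+b} λ_{p₁}λ_{p₂} q q`. The transcendental prefactors CANCEL in `Z² ≤ 4XY`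
(`((½)^{Δσ+Δε})² = (½)^{2Δσ}(½)^{2Δε}`), so `TaylorEvenRegion α Q E₀` follows from the purely algebraic
`X̂ ≥ 0, Ŷ ≥ 0, Ẑ² ≤ 4X̂Ŷ` on the cone (`taylorEvenRegion_half_of_qRegion`): polynomial inequalities in
`(E, j, Δσ, Δε)` with rational coefficients once `w` is rational — decidable box by box by a rational checker,
kernel-checkable by `norm_num`-class arithmetic per box (the (g2) TABLE's region part).
Sources: Kos–Poland–Simmons-Duffin 2014 §3.3; Hogervorst–Rychkov 2013 §3 eq. (3.6).
-/

namespace Summit.CriticalPhenomena.Ising3D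

open Finset Set
open Literature.MathematicalPhysics.QuantumFieldTheory.ConformalBootstrap3D

/-- The weighted q-sum of a component with weights `c` on the index set `S`:
`Σ_{(a,b)∈S} c(a,b) 2^{a+b} Σ_{p₁+p₂=j} λ_{p₁}λ_{p₂} (q¹q¹ + σ q²q²)`. [folklore] -/
noncomputable def qSum (c : ℕ × ℕ → ℝ) (S : Finset (ℕ × ℕ)) (s σ E : ℝ) (j : ℕ) : ℝ :=
  ∑ ab ∈ S, c ab * 2 ^ (ab.1 + ab.2) *
    ∑ p ∈ antidiagonal j, legendreLam p.1 * legendreLam p.2 *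
      (qFactor₁ s ((E - (j : ℝ)) / 2 + p.1) ab.1 * qFactor₁ s ((E - (j : ℝ)) / 2 + p.2) ab.2 +
        σ * (qFactor₂ s ((E - (j : ℝ)) / 2 + p.1) ab.1 * qFactor₂ s ((E - (j : ℝ)) / 2 + p.2) ab.2))

/-- A finite combination of Taylor coefficients at `(½,½)` on a term: prefactor times the q-sum.
[folklore] -/
theorem sum_smul_taylorCoeffAt_crossF_zMono_half (c : ℕ × ℕ → ℝ) (S : Finset (ℕ × ℕ)) (s σ E : ℝ)
    (j : ℕ) (hEj : (j : ℝ) ≤ E) :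
    (∑ ab ∈ S, c ab • taylorCoeffAt (1 / 2) (1 / 2) ab) (crossF s σ (zMono E j)) =
      (1 / 2 : ℝ) ^ (2 * s) * (1 / 2 : ℝ) ^ E * qSum c S s σ E j := by
  rw [LinearMap.sum_apply, qSum, Finset.mul_sum]
  refine Finset.sum_congr rfl fun ab _ => ?_
  rw [LinearMap.smul_apply, smul_eq_mul, taylorCoeffAt_crossF_zMono_half s σ E j hEj ab]
  ring

/-- **The polynomial region implies `TaylorEvenRegion`** for `α = taylorCrossing ½ ½ S w`: if on the cone
`E ≥ E₀, j ≤ E`, for every `(Δσ,Δε) ∈ Q`, `X̂ ≥ 0`, `Ŷ ≥ 0` and `Ẑ² ≤ 4 X̂ Ŷ` (q-sums as in the module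
docstring), then `TaylorEvenRegion (taylorCrossing ½ ½ S w) Q E₀`. [cite: KosPolandSimmonsduffin2014, §3.3 eq. (3.16)] -/
theorem taylorEvenRegion_half_of_qRegion (S : Finset (ℕ × ℕ)) (w : Fin 5 → ℕ × ℕ → ℝ)
    (Q : Set (ℝ × ℝ)) (E₀ : ℝ)
    (hq : ∀ p ∈ Q, ∀ (E : ℝ) (j : ℕ), E₀ ≤ E → (j : ℝ) ≤ E →
      0 ≤ qSum (w 0) S p.1 (-1) E j ∧ 0 ≤ qSum (w 1) S p.2 (-1) E j ∧
        (qSum (w 3) S ((p.1 + p.2) / 2) (-1) E j + qSum (w 4) S ((p.1 + p.2) / 2) 1 E j) ^ 2 ≤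
          4 * qSum (w 0) S p.1 (-1) E j * qSum (w 1) S p.2 (-1) E j) :
    TaylorEvenRegion (taylorCrossing (1 / 2) (1 / 2) S w) Q E₀ := by
  intro p hp E j hE hj
  obtain ⟨hX, hY, hZ⟩ := hq p hp E j hE hj
  have h0 : (0 : ℝ) < 1 / 2 := by norm_num
  -- the five components on the term
  have e1 : (taylorCrossing (1 / 2) (1 / 2) S w).α₁ (crossF p.1 (-1) (zMono E j)) =
      (1 / 2 : ℝ) ^ (2 * p.1) * (1 / 2 : ℝ) ^ E * qSum (w 0) S p.1 (-1) E j :=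
    sum_smul_taylorCoeffAt_crossF_zMono_half _ _ _ _ _ _ hj
  have e2 : (taylorCrossing (1 / 2) (1 / 2) S w).α₂ (crossF p.2 (-1) (zMono E j)) =
      (1 / 2 : ℝ) ^ (2 * p.2) * (1 / 2 : ℝ) ^ E * qSum (w 1) S p.2 (-1) E j :=
    sum_smul_taylorCoeffAt_crossF_zMono_half _ _ _ _ _ _ hj
  have e4 : (taylorCrossing (1 / 2) (1 / 2) S w).α₄ (crossF ((p.1 + p.2) / 2) (-1) (zMono E j)) =
      (1 / 2 : ℝ) ^ (2 * ((p.1 + p.2) / 2)) * (1 / 2 : ℝ) ^ E * qSum (w 3) S ((p.1 + p.2) / 2) (-1) E j :=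
    sum_smul_taylorCoeffAt_crossF_zMono_half _ _ _ _ _ _ hj
  have e5 : (taylorCrossing (1 / 2) (1 / 2) S w).α₅ (crossF ((p.1 + p.2) / 2) 1 (zMono E j)) =
      (1 / 2 : ℝ) ^ (2 * ((p.1 + p.2) / 2)) * (1 / 2 : ℝ) ^ E * qSum (w 4) S ((p.1 + p.2) / 2) 1 E j :=
    sum_smul_taylorCoeffAt_crossF_zMono_half _ _ _ _ _ _ hj
  -- positive prefactors and the cancellation
  set P₁ := (1 / 2 : ℝ) ^ (2 * p.1) * (1 / 2 : ℝ) ^ E with hP₁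
  set P₂ := (1 / 2 : ℝ) ^ (2 * p.2) * (1 / 2 : ℝ) ^ E with hP₂
  set P₃ := (1 / 2 : ℝ) ^ (2 * ((p.1 + p.2) / 2)) * (1 / 2 : ℝ) ^ E with hP₃
  have hP₁0 : 0 < P₁ := mul_pos (Real.rpow_pos_of_pos h0 _) (Real.rpow_pos_of_pos h0 _)
  have hP₂0 : 0 < P₂ := mul_pos (Real.rpow_pos_of_pos h0 _) (Real.rpow_pos_of_pos h0 _)
  have hP : P₃ * P₃ = P₁ * P₂ := by
    simp only [hP₁, hP₂, hP₃]
    rw [← Real.rpow_add h0, ← Real.rpow_add h0, ← Real.rpow_add h0, ← Real.rpow_add h0,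
      ← Real.rpow_add h0]
    congr 1
    ring
  rw [e1, e2, e4, e5]
  refine ⟨by positivity, by positivity, ?_⟩
  have h3 : (P₃ * qSum (w 3) S ((p.1 + p.2) / 2) (-1) E j + P₃ * qSum (w 4) S ((p.1 + p.2) / 2) 1 E j) ^ 2
      = P₁ * P₂ * (qSum (w 3) S ((p.1 + p.2) / 2) (-1) E j + qSum (w 4) S ((p.1 + p.2) / 2) 1 E j) ^ 2 := by
    rw [← hP]; ring
  rw [h3]
  have h4 : 4 * (P₁ * qSum (w 0) S p.1 (-1) E j) * (P₂ * qSum (w 1) S p.2 (-1) E j) =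
      P₁ * P₂ * (4 * qSum (w 0) S p.1 (-1) E j * qSum (w 1) S p.2 (-1) E j) := by ring
  rw [h4]
  exact mul_le_mul_of_nonneg_left hZ (mul_pos hP₁0 hP₂0).le

end Summit.CriticalPhenomena.Ising3D
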